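import Mathlib
import Literature.Analysis.ODE.InverseCoordSmooth
import Literature.Analysis.PDE.NearInverseSquareFarUnit
import Literature.Analysis.PDE.NearInverseSquareFarKernelFamily

/-!
# The exterior channel estimate at unit scale for near-inverse-square potentials

Analysis/PDE file (everything proved). **Theorem (`unitFarChannel`).** For every `n : ℕ` there are
`ε > 0` and `c > 0` such that for every continuous `W ≥ 0` on `ℝ` with

  `|W(y) − n(n+1)/y²| ≤ ε y^{-5/2}`  for `y ≥ ½`,

every global `C²` solution `φ` of `φ_tt − φ_yy + W φ = 0` satisfies the two-ended exterior channel
inequality on the unit cone `{y > 1 + |t|}`: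

  `c · inf_{p ∈ 𝒫} ∫_{y>1} e_W[φ − p](0,·) ≤ liminf_{t→+∞} ∫_{y>1+|t|} e_W[φ](t) + liminf_{t→−∞} …`,

`e_W = φ_t² + φ_y² + Wφ²`, where `𝒫` is the set of `C²` solutions on the cone that are polynomial in
`t` (the true non-radiative kernel). This generalises the exterior channel estimates of
Kenig–Lawrie–Liu–Schlag (Adv. Math. 285 (2015), the exact potential `n(n+1)/y²`, i.e. the radial
free wave equation in dimension `2n+3`) to long-range perturbations of size `O(y^{-5/2})`, with
constants depending only on `n`. Proof: `unitFarChannel_of_kernelFamily` (exact estimate + Duhamel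
comparison + kernel absorption, `NearInverseSquareFarUnit`) with the true kernel family of
`NearInverseSquareFarKernelFamily.trueKernelFamily`, for the smooth extension `ι` of `1/y`
(`InverseCoordSmooth`). It is the unit-scale far half of `FixedModeChannels`
(route PhotonSphereChannels, stmt-FinalStateConjecture-10048): composing with
`Summit.….Theorems.fixedModeChannels_of_unitFarChannel` re-proves that item.
-/

noncomputable section

namespace Literature.Analysis.PDE

open Set Filter MeasureTheory
open scoped Topology ENNReal

/-- **Exterior channel estimate at unit scale for near-inverse-square potentials.** See the module
docstring. [folklore] -/
theorem unitFarChannel (n : ℕ) :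
    ∃ ε : ℝ, 0 < ε ∧ ∃ c : ℝ, 0 < c ∧ ∀ W : ℝ → ℝ, Continuous W →
      (∀ y, 0 ≤ W y) →
      (∀ y : ℝ, 1 / 2 ≤ y → |W y - (n : ℝ) * ((n : ℝ) + 1) / y ^ 2| ≤ ε * y ^ (-(5 : ℝ) / 2)) →
      ∀ φ : ℝ → ℝ → ℝ, ContDiff ℝ 2 (Function.uncurry φ) →
      (∀ t y, iteratedDeriv 2 (fun τ => φ τ y) t - iteratedDeriv 2 (φ t) y + W y * φ t y = 0) →
      let e₁ : (ℝ → ℝ → ℝ) → ℝ → ℝ → ℝ := fun φ t x =>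
        deriv (fun τ => φ τ x) t ^ 2 + deriv (φ t) x ^ 2 + W x * φ t x ^ 2
      let IsSol₁ : (ℝ → ℝ → ℝ) → ℝ × ℝ → Prop := fun φ z =>
        iteratedDeriv 2 (fun τ => φ τ z.2) z.1 - iteratedDeriv 2 (φ z.1) z.2 + W z.2 * φ z.1 z.2 = 0
      let Ω₁ : Set (ℝ × ℝ) := {z | 1 + |z.1| < z.2}
      let P₁ : Set (ℝ → ℝ → ℝ) := {p | ContDiffOn ℝ 2 (Function.uncurry p) Ω₁ ∧
        (∀ z ∈ Ω₁, IsSol₁ p z) ∧ ∃ (N : ℕ) (a : ℕ → ℝ → ℝ), ∀ z ∈ Ω₁,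
          p z.1 z.2 = ∑ i ∈ Finset.range N, a i z.2 * z.1 ^ i}
      let E₁ : ℝ → ℝ≥0∞ := fun t => ∫⁻ x in Ioi (1 + |t|), ENNReal.ofReal (e₁ φ t x)
      ENNReal.ofReal c * (⨅ p ∈ P₁, ∫⁻ x in Ioi 1,
          ENNReal.ofReal (e₁ (fun t y => φ t y - p t y) 0 x))
        ≤ liminf E₁ atTop + liminf E₁ atBot := by
  obtain ⟨ι, hι, hιeq, -, I, hI, hI'⟩ := Literature.Analysis.ODE.exists_smooth_inv_extension
  exact unitFarChannel_of_kernelFamily hι hιeq hI hI' n (trueKernelFamily hι hιeq n)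

end Literature.Analysis.PDE
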